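import Summits.ValiantsHypothesis.ValiantsHypothesis.Theorems.LacunarySymmetroidMatrixDescartesCensusTropicalKLawStatic
import Summits.ValiantsHypothesis.ValiantsHypothesis.Theorems.KPlusLogSqLawTropicalBSplitDefs
import Summits.ValiantsHypothesis.ValiantsHypothesis.Theorems.KPlusLogSqLawTropicalPermutationChanges

/-!
# `TropicalB` — where a long dominant chain must spend its steps: permutation turnover (structural bookkeeping)

HONEST FRAMING.  Helper toward the crux `Summit.ValiantsHypothesis.ValiantsHypothesis.Theses.KPlusLogSqLaw.TropicalB`
(ledger item `stmt-ValiantsHypothesis-19771`, route `KPlusLogSqLaw`, regime stubs `stub_tropThin` / `stub_tropFat` of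
`Cruxes/TropicalB/Lines/birth.lean`; object-search cell `pub-symmetroid`, prover seat val-sym-trop-p3, 2026-08-26).
Two NON-COUNTING facts about a sign-alternating dominant chain `p₀, …, pₙ` (terms `pₖ = (σₖ, λₖ)`, unique optima at
strictly increasing integer slopes) of an arbitrary design of format `(m, K)`, in the tree's dominance vocabulary:

1. `chain_le_card_perms_mul` — **length ≤ (number of DISTINCT permutations used) · (m(K−1)+1)**: the thin law
   `tropRootLawAt_thin` with `m!` replaced by the actual permutation count `#{σₖ}` (for a fixed permutation the class
   vectors strictly increase in the product order of exponents, `d_lt_of_dominant`).  So a chain is long only through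
   MANY permutations: `#{σₖ} ≥ (n+1)/(m(K−1)+1)`.
2. `chain_le_permChanges_add` — `n ≤ P + m²(K−1)` where `P` is the number of permutation-CHANGING steps, from the
   class-switch budget `…TropicalPermutationChanges.card_samePerm_steps_le` (val-sym-lift-p2: at most `m²(K−1)` steps keep
   the permutation, because such a step strictly raises the entry-profile potential of the static reduction): an ADDITIVE
   complement to the multiplicative static reduction `tropRootLawAt_of_static`; and `static_steps_change_perm` (a static
   design changes the permutation at every step).

Reading (no claim beyond the theorems): at fixed `K` every super-quadratic growth of the tropical capacity `T(m,K)` —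
in particular the cell's open cubic question `TropK4Law 2` — and every super-polynomial growth in the window is
PERMUTATION TURNOVER (vertex turnover of the K-slope-graded Birkhoff shadow), never class switching.  Neither theorem
bounds `T(m,K)` inside the window `log₂ m + 1 < K < m`; nothing here bears on `TropicalB`, `KPlusLogSqLaw`,
`MatrixDescartes` or `VP ≠ VNP`.

FQN FIX (desk ruling R1333, 2026-08-26): the budget theorem `card_samePerm_steps_le` landed simultaneously in
val-sym-lift-p2's `…Theorems.KPlusLogSqLawTropicalPermutationChanges` (p419330, the REFERENCE declaration, hypothesis
`Function.Injective p`); this file imports it and keeps only the sign-alternating-chain corollaries, two of which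
(`chain_le_card_perms_mul`, `chain_le_permChanges_add`) are name-stable aliases of lift-p2's `succ_le_card_perms_mul` /
`le_permChanges_add`.

[folklore] potential / injectivity bookkeeping (`…TropicalKLawStatic`, `…TropicalPermutationChanges`);
`KPlusLogSqLaw.ne_succ_of_alternating` is val-sym-trop-p1's (`…TropicalBSplitDefs`).
-/

-- `Summit.ValiantsHypothesis.ValiantsHypothesis.…` repeats a component by the D-0017 layout (single-conjunct summit),
-- which the `dupNamespace` linter flags; the namespace is mandated (same as the sibling `…TropicalKLaw*` modules).
set_option linter.dupNamespace false
set_option autoImplicit false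

namespace Summit.ValiantsHypothesis.ValiantsHypothesis.Theorems.LacunarySymmetroidMatrixDescartes.TropicalCensus

open Summit.ValiantsHypothesis.ValiantsHypothesis.Theorems.MatrixDescartes.Negative
open scoped BigOperators
open Finset

variable {m K : ℕ}

/-! ## 1. Long chains use many permutations -/

/-- **Length ≤ (#distinct permutations) · (m(K−1)+1).**  Along a sign-alternating dominant chain the terms with a FIXED
permutation have class vectors strictly increasing in the product order of exponents (`d_lt_of_dominant`), hence
strictly increasing `termRank ∈ [0, m(K−1)]`; so `k ↦ (σₖ, termRank pₖ)` is injective into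
`{σₖ : k} × Fin (m(K−1)+1)`.  This is `tropRootLawAt_thin` with `m!` replaced by the number of permutations that
actually occur. [folklore] -/
theorem chain_le_card_perms_mul (d : Fin K → ℕ) (v ε : Fin m → Fin m → Fin K → ℤ) {n : ℕ}
    (θ : Fin (n + 1) → ℤ) (p : Fin (n + 1) → Equiv.Perm (Fin m) × (Fin m → Fin K))
    (hθ : StrictMono θ) (hdom : ∀ k, IsDominant d v ε (θ k) (p k))
    (halt : ∀ k : Fin n, termSign ε (p k.castSucc) * termSign ε (p k.succ) < 0) :
    n + 1 ≤ (univ.image fun k => (p k).1).card * (m * (K - 1) + 1) :=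
  succ_le_card_perms_mul d v ε n θ p hθ hdom halt

/-- Corollary in ratio form: a sign-alternating dominant chain with `n + 1` terms uses at least
`(n+1)/(m(K−1)+1)` distinct permutations. [folklore] -/
theorem card_perms_ge (d : Fin K → ℕ) (v ε : Fin m → Fin m → Fin K → ℤ) {n : ℕ}
    (θ : Fin (n + 1) → ℤ) (p : Fin (n + 1) → Equiv.Perm (Fin m) × (Fin m → Fin K))
    (hθ : StrictMono θ) (hdom : ∀ k, IsDominant d v ε (θ k) (p k))
    (halt : ∀ k : Fin n, termSign ε (p k.castSucc) * termSign ε (p k.succ) < 0) :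
    (n + 1) / (m * (K - 1) + 1) ≤ (univ.image fun k => (p k).1).card :=
  Nat.div_le_of_le_mul (by rw [mul_comm]; exact chain_le_card_perms_mul d v ε θ p hθ hdom halt)

/-! ## 2. At most `m²(K−1)` steps keep the permutation -/

/-! The class-switch budget `card_samePerm_steps_le` (at most `m·m·(K−1)` steps keep the permutation) is
`…TropicalPermutationChanges.card_samePerm_steps_le` (val-sym-lift-p2, p419330; hypothesis `Function.Injective p`, which a
sign-alternating chain satisfies by `stub_dominantInjective`). -/

/-- **`n ≤ P + m²(K−1)`**: the length of a sign-alternating dominant chain is at most the number `P` of its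
permutation-CHANGING steps plus the class-switch budget `m²(K−1)` — an additive complement to the multiplicative
static reduction `tropRootLawAt_of_static`. [folklore] -/
theorem chain_le_permChanges_add (d : Fin K → ℕ) (v ε : Fin m → Fin m → Fin K → ℤ) {n : ℕ}
    (θ : Fin (n + 1) → ℤ) (p : Fin (n + 1) → Equiv.Perm (Fin m) × (Fin m → Fin K))
    (hθ : StrictMono θ) (hdom : ∀ k, IsDominant d v ε (θ k) (p k))
    (halt : ∀ k : Fin n, termSign ε (p k.castSucc) * termSign ε (p k.succ) < 0) :
    n ≤ (univ.filter fun k : Fin n => (p k.castSucc).1 ≠ (p k.succ).1).card + m * m * (K - 1) :=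
  le_permChanges_add d v ε n θ p hθ hdom halt

/-- **Static designs change the permutation at EVERY step**: in a static design (`IsStatic ε`, one class per entry)
no step of a sign-alternating dominant chain keeps the permutation, since the class map of a present term is then
determined by its permutation. [folklore] -/
theorem static_steps_change_perm (ε : Fin m → Fin m → Fin K → ℤ) (hst : IsStatic ε) {n : ℕ}
    (p : Fin (n + 1) → Equiv.Perm (Fin m) × (Fin m → Fin K))
    (hpres : ∀ k, termSign ε (p k) ≠ 0)
    (halt : ∀ k : Fin n, termSign ε (p k.castSucc) * termSign ε (p k.succ) < 0) (k : Fin n) :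
    (p k.castSucc).1 ≠ (p k.succ).1 := by
  intro hσ
  apply KPlusLogSqLaw.ne_succ_of_alternating ε p halt k
  refine Prod.ext hσ (funext fun i => ?_)
  have h1 := present_of_termSign_ne_zero ε (p k.castSucc) (hpres _) i
  have h2 := present_of_termSign_ne_zero ε (p k.succ) (hpres _) i
  rw [hσ] at h1
  exact hst _ _ _ _ h1 h2

end Summit.ValiantsHypothesis.ValiantsHypothesis.Theorems.LacunarySymmetroidMatrixDescartes.TropicalCensus
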